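import Summits.QuantumFields.YangMills.Theorems.BalabanUVNodesN27AtRecord11
import Summits.QuantumFields.YangMills.Theorems.BalabanUVNodesN27KeyedKnit
import Literature.MathematicalPhysics.QuantumFieldTheory.Balaban1983to89.Node00.Record12
import Literature.MathematicalPhysics.QuantumFieldTheory.Balaban1983to89.Node00.Record12CarriersB13

/-!
# BalabanUVNodes ∕ N27 = binder B5 AT THE RECORD, XXV — N27 AT NODE 00's REPAIRED STAGE-12 RECORD `Node00.IsRecordOfRecord₁₂C` (def-T `Node00/Record12.lean`
# 12b v2.1 p459432 ✓ 209c490d79f3: level-0 background by value, 𝐓-weights pinned, no all-runs radii field, locality law; the v2.2 re-point of `UbgOfRecord₁₂`'s `n+1`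
# branch — director LINE №101 — moves none of the names read here): the ₅C shadow ∕ tower roads, the INSTANCE of the stage-generic
# keyed knit XXIV at the Stage-12 key, and the honesty face «XXIII's Stage-11 vacuity does NOT transfer to Stage 12»
# (cell `pub-ymgap`, HUMAN RULING D-0062 Track A, R134 seat `pub-ymgap-dag-n27-c` (s2) gen 2; dag-lead WORDS-104 (A)(iii) «₁₂ twins may file by import now … n27-c's
# K3′-side knit»; `--supports stmt-QuantumFields-19676` until the ₁₂ re-pin (route rev 10, director LINE №97) gives K3′ `SpineGivenEndpointR12` its id; COUNT-NEUTRAL; `N`-generic, NO Theses import — restate-immune;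
# the route-facing `N = 2` one-liners for K3′ follow as module XXVI the hour the rev-10 decl exists)

WHAT IS KERNEL-CHECKED ([bookkeeping]; 0 `def`, 0 `sorry`; every stub ∕ reading ∕ edge a HYPOTHESIS or PARAMETER — 0∕1 at every record today).
* §1 ROADS FROM ₅C (XX §1∕§1′ twins over def-T's ₁₂ faces BY NAME): `b5_of_isRecordOfRecord₁₂C` · `spine_rec12C_of_spine_rec5C` (`Spine ₅C → Spine ₁₂C`, XVI `spine_of_shadow` at
  `Node00.exists_isRecordOfRecord₅C_of_isRecordOfRecord₁₂C`) · `b5_datumOfRecord₁₂_of_spine₅C` · `towerBound_of_isRecordOfRecord₁₂C` · `spine_rec12C_of_coarser` (XVII `spine_of_towerBound`).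
* §2 THE XXIV INSTANCE AT THE STAGE-12 KEY `(Θ, Hp, Adm, datumOf) := (Stage12Params, Provisos₁₂, Admissible, datumOfRecord₁₂)`: the two interface lemmas (K1) `keyed₁₂_of_isRecordOfRecord₁₂C`
  (= def-T's `exists_provisos_of_isRecordOfRecord₁₂C`) and (K2) `exists_world_of_keyed₁₂` (`exists_world_isRecordOfRecord₁₂C` at window `θ.γ`, `0 < θ.γ` from admissibility); then
  `spine_rec12C_iff_forall_datumOfRecord₁₂` (B5 at ₁₂C ⟺ B5 at every `datumOfRecord₁₂ F N θ h`, worlds eliminated) · `spine_rec12C_of_keyedFaces` (B5 at ₁₂C from N20 ∕ N21 at a spine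
  reading `cr`, K4's six rates at a rate reading `rr`, the same-tuple N19′ edge and the keyed extraction clause — readings off `(θ : Stage12Params F N, h : θ.Provisos₁₂ F N)`,
  PARAMETERS: no Stage-12 carrier home exists yet) · `s_R00x_rec12C_of_keyed` (R00x FREE at a characterised rate record) · `spine_rec12C_of_rateStubs_twoKeys₁₂` (the divided-home shape:
  `SRec`∕`RRec` characterised by `cr`∕`rr`, K4∕K5 stubs at them, PAIR-FORM N19′ edge) · `spine_rec12C_of_rateStubs_twoKeys₁₂_of_datumDetermined` (canonical-key road).
* §4 `k3Shape_iff_spine_rec12C` — K3's text re-keyed over ₁₂C (the `(D, w)` form) at generic `N` ⟺ `Spine ₁₂C` (XX §4's twin) · `k3ShapeUnity_of_spine_rec12C` — director LINE №99 (2)'s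
  UNITY-THREADED θ-keyed K3′ sentence («∀ θ h, θ.ZtUnity F N → θ.Admissible → (B) → END → …») follows from `Spine ₁₂C` a fortiori.
* §5 `keyedUnity₁₂_of_keyedFaces` — THE UNITY-KEYED FORM: the K3′ conclusion at every UNITY-admissible Stage-12 datum from the five keyed faces asked ONLY on print's
  partition-of-unity class `θ.ZtUnity` (XXIV at the key `Adm := ZtUnity ∧ Admissible`, world-free keyed-datum class; stage-generic form = companion XXIVb).
* §3 HONESTY AT STAGE 12: `flow_g_zero_datumOfRecord₁₂` (the bare coupling of the run `P` IS `P.g0`) · `not_levelZeroNegative_datumOfRecord₁₂` — the hypothesis of XXIII's road (ii)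
  «no level-0 §2 form at positive bare coupling» FAILS at EVERY Stage-12 datum (`Node00.sect2Form_zero_datumOfRecord₁₂` at the run `⟨0, 0, 1⟩`): the Stage-11 vacuity mechanism
  (n13-e `not_sLaw₁₁_zero` ∕ XXIII) does NOT transfer; whether `IsRecordOfRecord₁₂C` is inhabited is the re-pin's item K0′ `Record12Inhabited`, open.

HONEST FRAMING.  COMPOSITE-node bookkeeping: nothing of Bałaban's is asserted or instantiated; NE7 ∕ NE7b ∕ NE7c NOT PRINTED for d = 4 and NOT PROVED; NO node discharged; K3 HELD
(R166), K3′ not yet born (route rev 10 pending) — neither is claimed; counts UNMOVED (typed 28∕28 · discharged 5∕27, A 5∕28); one finite four-torus programme at fixed `ε` — NOT ℝ⁴, NOT infinite volume,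
NOT OS, NOT a mass gap, NOT Clay.  No decl below carries a cite tag.
-/

namespace Summit.QuantumFields.YangMills.Theorems.BalabanUVNodesN27SpineRecord

open Literature.MathematicalPhysics.QuantumFieldTheory.Balaban1983to89
open Literature.MathematicalPhysics.QuantumFieldTheory.Balaban1983to89.T4Continuum
open Literature.MathematicalPhysics.QuantumFieldTheory.Balaban1983to89.T4DatumAssembly
open T4WeightBudget (RelWeightBound)
open T4IndicatorShell (ShellWeightBound)
open T4ContinuumYM4Torus (ForSmallCouplings)
open Summit.QuantumFields.BalabanUV.T4Continuum.Spine
open YMDAG.UVSplit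
open Node00 (Stage12Params datumOfRecord₁₂ IsRecordOfRecord₁₂C)

variable {N : ℕ} [NeZero N]

/-! ## §1 The ₅C roads at Stage 12 -/

section Roads

/-- **B5 AT ONE STAGE-12 RECORD PAIR from `Spine ₅C`**: the world of a ₁₂C record is a ₅C record at the shadow datum with the same `C` and `av`
(`Node00.exists_isRecordOfRecord₅C_of_isRecordOfRecord₁₂C`); B5 reads nothing else (XVI `b5_congr`). [bookkeeping] -/
theorem b5_of_isRecordOfRecord₁₂C (h₅ : Spine (N := N) fun F D w => Node00.IsRecordOfRecord₅C F N D w)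
    {F : T4Family} {D : Datum F N} {w : DagBinding.WorldP} (h : IsRecordOfRecord₁₂C F N D w) :
    T4ApexHybrid.HybridNE7Under D (DagBinding.EndpointExistence D.C.toB12) := by
  obtain ⟨D₅, h5, hC, -, -, hav⟩ := Node00.exists_isRecordOfRecord₅C_of_isRecordOfRecord₁₂C h
  exact (b5_congr hC hav).mp (h₅ F D₅ w h5)

/-- **THE ₁₂C CLOSER OF THE COMPOSITE NODE, SHADOW ROAD**: `Spine ₅C → Spine ₁₂C` (XVI `spine_of_shadow`). [bookkeeping] -/
theorem spine_rec12C_of_spine_rec5C (h₅ : Spine (N := N) fun F D w => Node00.IsRecordOfRecord₅C F N D w) :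
    Spine (N := N) fun F D w => IsRecordOfRecord₁₂C F N D w :=
  spine_of_shadow (Rec' := fun F D w => Node00.IsRecordOfRecord₅C F N D w) (fun F D w h => by
    obtain ⟨D₅, h5, hC, -, -, hav⟩ := Node00.exists_isRecordOfRecord₅C_of_isRecordOfRecord₁₂C h
    exact ⟨D₅, h5, hC, hav⟩) h₅

/-- **B5 AT EVERY STAGE-12 DATUM OF RECORD from `Spine ₅C`** (the datum is a ₁₂C record at some world: `Node00.exists_world_isRecordOfRecord₁₂C`, window `θ.γ`).
[bookkeeping] -/
theorem b5_datumOfRecord₁₂_of_spine₅C (h₅ : Spine (N := N) fun F D w => Node00.IsRecordOfRecord₅C F N D w)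
    (F : T4Family) (θ : Stage12Params F N) (h : θ.Provisos₁₂ F N) (hθ : θ.Admissible F N) :
    T4ApexHybrid.HybridNE7Under (datumOfRecord₁₂ F N θ h) (DagBinding.EndpointExistence (datumOfRecord₁₂ F N θ h).C.toB12) := by
  obtain ⟨w, hw, -⟩ := Node00.exists_world_isRecordOfRecord₁₂C F N θ h hθ (γw := θ.γ) ⟨hθ.1.1.1.1.2, le_rfl⟩
  exact b5_of_isRecordOfRecord₁₂C h₅ hw

/-- **EVERY ₁₂C RECORD PAIR IS TOWER-BOUND** (XVII's shape): the datum IS the tower datum of the machine of the SHADOW Stage-5 parameters `Node00.shadow₅OfRecord₁₂ F N θ h w.γ`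
and the tower of record `Node00.towerOfRecord₁₂ F N θ h` (`rfl`, def-T's `toCore_machineOfRecord₅_shadow₁₂`), the world bound with the shadow's letters. [bookkeeping] -/
theorem towerBound_of_isRecordOfRecord₁₂C {F : T4Family} {D : Datum F N} {w : DagBinding.WorldP} (h : IsRecordOfRecord₁₂C F N D w) :
    ∃ (θ : Node00.Stage5Params F N) (_ : θ.Admissible) (τ : (Node00.machineOfRecord₅ F N θ).toCore.Tower (Node00.avOfRecord F N)),
      (∀ (p : B12.RunParams) (k : ℕ), θ.res.R p k = τ.shadowR p k) ∧
      D = datumOfTower F N (Node00.machineOfRecord₅ F N θ).toCore τ ∧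
      w.C = D.C ∧ w.γ = θ.γ ∧ w.L = (θ.L : ℝ) ∧ (∀ P : B12.RunParams, w.up P = Node00.upOfRecord₅C F N θ P) := by
  obtain ⟨θ, hP, hθ, rfl, hC, ⟨hγ0, -⟩, hL, hup⟩ := h
  exact ⟨Node00.shadow₅OfRecord₁₂ F N θ hP w.γ, Node00.admissible_shadow₁₂ F N θ hP hθ hγ0, Node00.towerOfRecord₁₂ F N θ hP,
    fun _ _ => rfl, rfl, hC, rfl, hL, hup⟩

/-- **TOWER ROAD**: B5 at ANY record predicate coarser than ₅C gives B5 at ₁₂C (XII `spine_antitone`, XVII `spine_of_towerBound`). [bookkeeping] -/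
theorem spine_rec12C_of_coarser {Rec : RecordPred N}
    (hle : ∀ (F : T4Family) (D : Datum F N) (w : DagBinding.WorldP), Node00.IsRecordOfRecord₅C F N D w → Rec F D w) (h : Spine Rec) :
    Spine (N := N) fun F D w => IsRecordOfRecord₁₂C F N D w :=
  spine_of_towerBound N (fun _ _ _ h12 => towerBound_of_isRecordOfRecord₁₂C h12) (spine_antitone hle h)

end Roads

/-! ## §2 The XXIV instance at the Stage-12 key -/

section Keyed

/-- **(K1) AT STAGE 12**: every ₁₂C record pair is keyed — an admissible `θ : Stage12Params F N` with provisos realises the datum (def-T's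
`exists_provisos_of_isRecordOfRecord₁₂C`, restated in XXIV's binder order). [bookkeeping] -/
theorem keyed₁₂_of_isRecordOfRecord₁₂C (F : T4Family) (D : Datum F N) (w : DagBinding.WorldP) (h : IsRecordOfRecord₁₂C F N D w) :
    ∃ (θ : Stage12Params F N) (hP : θ.Provisos₁₂ F N), θ.Admissible F N ∧ D = datumOfRecord₁₂ F N θ hP :=
  Node00.exists_provisos_of_isRecordOfRecord₁₂C h

/-- **(K2) AT STAGE 12**: every admissible Stage-12 tuple with provisos is a ₁₂C record at its datum for some world (window `θ.γ`; `0 < θ.γ` is Stage-1 admissibility).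
[bookkeeping] -/
theorem exists_world_of_keyed₁₂ (F : T4Family) (θ : Stage12Params F N) (hP : θ.Provisos₁₂ F N) (hθ : θ.Admissible F N) :
    ∃ w : DagBinding.WorldP, IsRecordOfRecord₁₂C F N (datumOfRecord₁₂ F N θ hP) w := by
  obtain ⟨w, hw, -⟩ := Node00.exists_world_isRecordOfRecord₁₂C F N θ hP hθ (γw := θ.γ) ⟨hθ.1.1.1.1.2, le_rfl⟩
  exact ⟨w, hw⟩

/-- **B5 AT ₁₂C ⟺ B5 AT EVERY STAGE-12 DATUM OF RECORD** (worlds eliminated; XXIV `spine_iff_forall_keyed` at the Stage-12 key). [bookkeeping] -/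
theorem spine_rec12C_iff_forall_datumOfRecord₁₂ :
    Spine (N := N) (fun F D w => IsRecordOfRecord₁₂C F N D w) ↔
      ∀ (F : T4Family) (θ : Stage12Params F N) (hP : θ.Provisos₁₂ F N), θ.Admissible F N →
        T4ApexHybrid.HybridNE7Under (datumOfRecord₁₂ F N θ hP) (DagBinding.EndpointExistence (datumOfRecord₁₂ F N θ hP).C.toB12) :=
  spine_iff_forall_keyed (Θ := fun F => Stage12Params F N) (fun θ => θ.Provisos₁₂ _ N) (fun θ => θ.Admissible _ N)
    (fun θ h => datumOfRecord₁₂ _ N θ h) _ keyed₁₂_of_isRecordOfRecord₁₂C exists_world_of_keyed₁₂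

variable (cr : (F : T4Family) → (θ : Stage12Params F N) → θ.Provisos₁₂ F N → (ℕ → ℝ) → List (ULoop F) → SpineCarriers)
  (rr : (F : T4Family) → (θ : Stage12Params F N) → θ.Provisos₁₂ F N → (ℕ → ℝ) → List (ULoop F) → RateCarriers N)

/-- **N27 = B5 AT THE STAGE-12 RECORD FROM THE CHILDREN'S ESTIMATES READ OFF THE SAME STAGE-12 TUPLE** (XXIV `spine_of_keyedFaces` at the Stage-12 key): N20 `RelWeightBound` and N21
`ShellWeightBound` at `cr F θ h g₀ os`, K4's six rates jointly at `rr F θ h g₀ os` on `datumOfRecord₁₂ F N θ h`, the same-tuple N19′ edge, and the keyed extraction clause (positivity +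
E1∕E2 under (B), END, small tuned couplings) for EVERY admissible Stage-12 θ with provisos ⇒ `Spine ₁₂C`.  Every hypothesis 0∕1; `cr`, `rr` PARAMETERS. [bookkeeping] -/
theorem spine_rec12C_of_keyedFaces
    (h20 : ∀ (F : T4Family) (θ : Stage12Params F N) (hP : θ.Provisos₁₂ F N), θ.Admissible F N → ∀ (g₀ : ℕ → ℝ) (os : List (ULoop F)),
      RelWeightBound (cr F θ hP g₀ os).l₀ (cr F θ hP g₀ os).T (cr F θ hP g₀ os).A (cr F θ hP g₀ os).B (cr F θ hP g₀ os).Bad (cr F θ hP g₀ os).W)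
    (h21 : ∀ (F : T4Family) (θ : Stage12Params F N) (hP : θ.Provisos₁₂ F N), θ.Admissible F N → ∀ (g₀ : ℕ → ℝ) (os : List (ULoop F)),
      ShellWeightBound (cr F θ hP g₀ os).l₀ (cr F θ hP g₀ os).T (cr F θ hP g₀ os).A (cr F θ hP g₀ os).B (cr F θ hP g₀ os).shA (cr F θ hP g₀ os).shB
        (cr F θ hP g₀ os).Wsh)
    (hrates : ∀ (F : T4Family) (θ : Stage12Params F N) (hP : θ.Provisos₁₂ F N), θ.Admissible F N → ∀ (g₀ : ℕ → ℝ) (os : List (ULoop F)),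
      RatesAt (datumOfRecord₁₂ F N θ hP) (rr F θ hP g₀ os))
    (h19 : ∀ (F : T4Family) (θ : Stage12Params F N) (hP : θ.Provisos₁₂ F N), θ.Admissible F N → ∀ (g₀ : ℕ → ℝ) (os : List (ULoop F)),
      RatesAt (datumOfRecord₁₂ F N θ hP) (rr F θ hP g₀ os) → letI := (cr F θ hP g₀ os).dec
        ∃ δ : ℕ → ℝ, NE7.Core (cr F θ hP g₀ os).l₀ (cr F θ hP g₀ os).vol (cr F θ hP g₀ os).T (cr F θ hP g₀ os).Bad
          (fun K t τ => (cr F θ hP g₀ os).A K t τ - (cr F θ hP g₀ os).shA K t τ) (fun K t τ => (cr F θ hP g₀ os).B K t τ - (cr F θ hP g₀ os).shB K t τ) δ ∧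
          Summable δ)
    (hx : ∀ (F : T4Family) (θ : Stage12Params F N) (hP : θ.Provisos₁₂ F N), θ.Admissible F N →
      B16.EndStatementBPrinted (datumOfRecord₁₂ F N θ hP).C → DagBinding.EndpointExistence (datumOfRecord₁₂ F N θ hP).C.toB12 →
        ForSmallCouplings (datumOfRecord₁₂ F N θ hP) fun g₀ => ∀ os : List (ULoop F),
          0 < (cr F θ hP g₀ os).l₀ ∧ 0 < (cr F θ hP g₀ os).vol ∧
          (∀ (K : ℕ) (t : ℝ), |t| ≤ (cr F θ hP g₀ os).l₀ →
            T4GenFunBounds.schemeZ ((datumOfRecord₁₂ F N θ hP).scheme g₀) os ((cr F θ hP g₀ os).K₀ + K) t =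
              ∑ τ ∈ (cr F θ hP g₀ os).T K, (cr F θ hP g₀ os).A K t τ) ∧
          (∀ (K : ℕ) (t : ℝ), |t| ≤ (cr F θ hP g₀ os).l₀ →
            T4GenFunBounds.schemeZ ((datumOfRecord₁₂ F N θ hP).scheme g₀) os ((cr F θ hP g₀ os).K₀ + K + 1) t =
              ∑ τ ∈ (cr F θ hP g₀ os).T K, (cr F θ hP g₀ os).B K t τ)) :
    Spine (N := N) fun F D w => IsRecordOfRecord₁₂C F N D w :=
  spine_of_keyedFaces (Θ := fun F => Stage12Params F N) (fun θ => θ.Provisos₁₂ _ N) (fun θ => θ.Admissible _ N) (fun θ h => datumOfRecord₁₂ _ N θ h) _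
    (fun θ h => cr _ θ h) (fun θ h => rr _ θ h) keyed₁₂_of_isRecordOfRecord₁₂C h20 h21 hrates h19 hx

variable (SRec : SpineRecordPred N) (RRec : RateRecordPred N)

/-- **R00x IS FREE AT A STAGE-12-CHARACTERISED RATE RECORD** (XXIV `s_R00x_of_keyed` at the Stage-12 key): the reading `rr F θ h g₀ os` is pinned at its own datum.  LOCATED:
the K4 existence stub carries no content at a keyed home. [bookkeeping] -/
theorem s_R00x_rec12C_of_keyed
    (hkeyR : ∀ (F : T4Family) (D : Datum F N) (g₀ : ℕ → ℝ) (os : List (ULoop F)) (R : RateCarriers N), RRec F D g₀ os R ↔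
      ∃ (θ : Stage12Params F N) (hP : θ.Provisos₁₂ F N), θ.Admissible F N ∧ D = datumOfRecord₁₂ F N θ hP ∧ R = rr F θ hP g₀ os) :
    S_R00x (fun F D w => IsRecordOfRecord₁₂C F N D w) RRec :=
  s_R00x_of_keyed (Θ := fun F => Stage12Params F N) (fun θ => θ.Provisos₁₂ _ N) (fun θ => θ.Admissible _ N) (fun θ h => datumOfRecord₁₂ _ N θ h) _ RRec
    (fun θ h => rr _ θ h) hkeyR keyed₁₂_of_isRecordOfRecord₁₂C

/-- **N27 = B5 AT THE STAGE-12 RECORD FROM THE STUB INSTANCES OF A DIVIDED STAGE-12 CARRIER HOME** (XXIV `spine_of_rateStubs_twoKeys` at the Stage-12 key): for ANY `SRec`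
characterised by a Stage-12 spine reading `cr` and ANY `RRec` characterised by a Stage-12 rate reading `rr`, the K4 stubs `S_R00x ₁₂C RRec` · `S_N14`–`S_N18`, `S_N22` at `RRec`, the K5
stubs `S_N27x ₁₂C SRec` · `S_N20` · `S_N21` at `SRec` and the PAIR-FORM N19′ edge give `Spine ₁₂C`.  Every stub a HYPOTHESIS (0∕1; no Stage-12 carrier home exists yet — the
shape the ₁₂ twins of (T-SPINE)∕(T-RATE) will meet by `Iff.rfl`). [bookkeeping] -/
theorem spine_rec12C_of_rateStubs_twoKeys₁₂
    (hkeyS : ∀ (F : T4Family) (D : Datum F N) (g₀ : ℕ → ℝ) (os : List (ULoop F)) (S : SpineCarriers), SRec F D g₀ os S ↔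
      ∃ (θ : Stage12Params F N) (hP : θ.Provisos₁₂ F N), θ.Admissible F N ∧ D = datumOfRecord₁₂ F N θ hP ∧ S = cr F θ hP g₀ os)
    (hkeyR : ∀ (F : T4Family) (D : Datum F N) (g₀ : ℕ → ℝ) (os : List (ULoop F)) (R : RateCarriers N), RRec F D g₀ os R ↔
      ∃ (θ : Stage12Params F N) (hP : θ.Provisos₁₂ F N), θ.Admissible F N ∧ D = datumOfRecord₁₂ F N θ hP ∧ R = rr F θ hP g₀ os)
    (hx : S_R00x (fun F D w => IsRecordOfRecord₁₂C F N D w) RRec) (h14 : S_N14 RRec) (h15 : S_N15 RRec) (h16 : S_N16 RRec) (h17 : S_N17 RRec)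
    (h18 : S_N18 RRec) (h22 : S_N22 RRec) (hx' : S_N27x (fun F D w => IsRecordOfRecord₁₂C F N D w) SRec) (h20 : S_N20 SRec) (h21 : S_N21 SRec)
    (h19₂ : ∀ (F : T4Family) (θ : Stage12Params F N) (hP : θ.Provisos₁₂ F N) (θ' : Stage12Params F N) (hP' : θ'.Provisos₁₂ F N),
      θ.Admissible F N → θ'.Admissible F N → datumOfRecord₁₂ F N θ' hP' = datumOfRecord₁₂ F N θ hP → ∀ (g₀ : ℕ → ℝ) (os : List (ULoop F)),
        RatesAt (datumOfRecord₁₂ F N θ hP) (rr F θ' hP' g₀ os) → letI := (cr F θ hP g₀ os).dec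
          ∃ δ : ℕ → ℝ, NE7.Core (cr F θ hP g₀ os).l₀ (cr F θ hP g₀ os).vol (cr F θ hP g₀ os).T (cr F θ hP g₀ os).Bad
            (fun K t τ => (cr F θ hP g₀ os).A K t τ - (cr F θ hP g₀ os).shA K t τ) (fun K t τ => (cr F θ hP g₀ os).B K t τ - (cr F θ hP g₀ os).shB K t τ) δ ∧
            Summable δ) :
    Spine (N := N) fun F D w => IsRecordOfRecord₁₂C F N D w :=
  spine_of_rateStubs_twoKeys (Θ := fun F => Stage12Params F N) (fun θ => θ.Provisos₁₂ _ N) (fun θ => θ.Admissible _ N) (fun θ h => datumOfRecord₁₂ _ N θ h) _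
    SRec RRec (fun θ h => cr _ θ h) (fun θ h => rr _ θ h) hkeyS hkeyR hx h14 h15 h16 h17 h18 h22 hx' h20 h21 h19₂

/-- **THE CANONICAL-KEY ROAD AT STAGE 12**: with a DATUM-DETERMINED Stage-12 rate reading the single-tuple N19′ edge suffices (XXIV `spine_of_rateStubs_twoKeys_of_datumDetermined`).
[bookkeeping] -/
theorem spine_rec12C_of_rateStubs_twoKeys₁₂_of_datumDetermined
    (hkeyS : ∀ (F : T4Family) (D : Datum F N) (g₀ : ℕ → ℝ) (os : List (ULoop F)) (S : SpineCarriers), SRec F D g₀ os S ↔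
      ∃ (θ : Stage12Params F N) (hP : θ.Provisos₁₂ F N), θ.Admissible F N ∧ D = datumOfRecord₁₂ F N θ hP ∧ S = cr F θ hP g₀ os)
    (hkeyR : ∀ (F : T4Family) (D : Datum F N) (g₀ : ℕ → ℝ) (os : List (ULoop F)) (R : RateCarriers N), RRec F D g₀ os R ↔
      ∃ (θ : Stage12Params F N) (hP : θ.Provisos₁₂ F N), θ.Admissible F N ∧ D = datumOfRecord₁₂ F N θ hP ∧ R = rr F θ hP g₀ os)
    (hdetR : ∀ (F : T4Family) (θ : Stage12Params F N) (hP : θ.Provisos₁₂ F N) (θ' : Stage12Params F N) (hP' : θ'.Provisos₁₂ F N),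
      θ.Admissible F N → θ'.Admissible F N → datumOfRecord₁₂ F N θ' hP' = datumOfRecord₁₂ F N θ hP → ∀ (g₀ : ℕ → ℝ) (os : List (ULoop F)),
        rr F θ' hP' g₀ os = rr F θ hP g₀ os)
    (hx : S_R00x (fun F D w => IsRecordOfRecord₁₂C F N D w) RRec) (h14 : S_N14 RRec) (h15 : S_N15 RRec) (h16 : S_N16 RRec) (h17 : S_N17 RRec)
    (h18 : S_N18 RRec) (h22 : S_N22 RRec) (hx' : S_N27x (fun F D w => IsRecordOfRecord₁₂C F N D w) SRec) (h20 : S_N20 SRec) (h21 : S_N21 SRec)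
    (h19 : ∀ (F : T4Family) (θ : Stage12Params F N) (hP : θ.Provisos₁₂ F N), θ.Admissible F N → ∀ (g₀ : ℕ → ℝ) (os : List (ULoop F)),
      RatesAt (datumOfRecord₁₂ F N θ hP) (rr F θ hP g₀ os) → letI := (cr F θ hP g₀ os).dec
        ∃ δ : ℕ → ℝ, NE7.Core (cr F θ hP g₀ os).l₀ (cr F θ hP g₀ os).vol (cr F θ hP g₀ os).T (cr F θ hP g₀ os).Bad
          (fun K t τ => (cr F θ hP g₀ os).A K t τ - (cr F θ hP g₀ os).shA K t τ) (fun K t τ => (cr F θ hP g₀ os).B K t τ - (cr F θ hP g₀ os).shB K t τ) δ ∧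
          Summable δ) :
    Spine (N := N) fun F D w => IsRecordOfRecord₁₂C F N D w :=
  spine_of_rateStubs_twoKeys_of_datumDetermined (Θ := fun F => Stage12Params F N) (fun θ => θ.Provisos₁₂ _ N) (fun θ => θ.Admissible _ N)
    (fun θ h => datumOfRecord₁₂ _ N θ h) _ SRec RRec (fun θ h => cr _ θ h) (fun θ h => rr _ θ h) hkeyS hkeyR hdetR hx h14 h15 h16 h17 h18 h22 hx' h20 h21 h19

end Keyed

/-! ## §3 Honesty at Stage 12: XXIII's Stage-11 vacuity mechanism does NOT transfer -/

section Honesty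

/-- The bare coupling of the run `P` of a Stage-12 datum IS `P.g0` (`flow_g_datumOfRecord₁₂` ▸ `genSeq_zero`). [bookkeeping] -/
theorem flow_g_zero_datumOfRecord₁₂ {F : T4Family} (θ : Stage12Params F N) (h : θ.Provisos₁₂ F N) (P : B12.RunParams) :
    ((datumOfRecord₁₂ F N θ h).C P).flow.g 0 = P.g0 := by
  rw [Node00.flow_g_datumOfRecord₁₂]
  exact FlowStepRuns.genSeq_zero _ _

/-- **XXIII's ROAD (ii) IS CLOSED AT STAGE 12**: the hypothesis «no level-0 §2 form at positive bare coupling» of `forSmallCouplings_of_thm1Printed_of_not_sect2Form_zero` FAILS at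
EVERY Stage-12 datum — at the run `⟨0, 0, 1⟩` the bare coupling is `1 > 0` and the step-0 §2 clause HOLDS (def-T's `Node00.sect2Form_zero_datumOfRecord₁₂`, the repaired base).  So
the Stage-11 vacuity certificate (n13-e `not_sLaw₁₁_zero` ∕ module XXIII) does not type-check here; B5 at ₁₂C has content exactly where (B) and END hold. [bookkeeping] -/
theorem not_levelZeroNegative_datumOfRecord₁₂ {F : T4Family} (θ : Stage12Params F N) (h : θ.Provisos₁₂ F N) :
    ¬ ∀ P : B12.RunParams, 0 < ((datumOfRecord₁₂ F N θ h).C P).flow.g 0 → ¬ ((datumOfRecord₁₂ F N θ h).C P).Sect2Form 0 := by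
  intro hneg
  refine hneg ⟨0, 0, 1⟩ ?_ (Node00.sect2Form_zero_datumOfRecord₁₂ F N θ h _)
  rw [flow_g_zero_datumOfRecord₁₂]
  exact one_pos

end Honesty

/-! ## §4 The re-pinned K3′ shape at generic `N` -/

section K3Shape

/-- **K3's TEXT RE-KEYED OVER ₁₂C (the `(D, w)` form) IS `Spine ₁₂C`**: «at every Stage-12 record pair, (B)(D.C) → END(D.C.toB12) → `T4ApexHybrid.HybridNE7Under D END`» ⟺ `Spine ₁₂C`
(B5-under-END is itself `(B) → END → ForSmallCouplings …`, definitional: →: apply at the antecedents twice; ←: weaken) — director LINE №86 (2)'s first re-pin text; the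
θ-keyed unity-threaded text of LINE №99 (2) (plan g64's `SpineGivenEndpointR12`, route rev 10) is `k3ShapeUnity_of_spine_rec12C` below and §5. [bookkeeping] -/
theorem k3Shape_iff_spine_rec12C :
    (∀ (F : T4Family) (D : Datum F N) (w : DagBinding.WorldP), IsRecordOfRecord₁₂C F N D w →
      B16.EndStatementBPrinted D.C → DagBinding.EndpointExistence D.C.toB12 →
        T4ApexHybrid.HybridNE7Under D (DagBinding.EndpointExistence D.C.toB12)) ↔
    Spine (N := N) fun F D w => IsRecordOfRecord₁₂C F N D w := by
  refine ⟨fun h F D w hR => ?_, fun h F D w hR _ _ => h F D w hR⟩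
  show D.UnderHypotheses _ fun g₀ => T4ApexHybrid.StringwiseHybridNE7 (D.scheme g₀)
  intro hB hEnd
  exact h F D w hR hB hEnd hB hEnd

/-- **THE UNITY-THREADED K3′ SHAPE FROM `Spine ₁₂C`** (director LINE №99 (2): every rev-10 item ranges over records whose 𝐓-weights are print's partition of unity, the NAMED
predicate `Stage12Params.ZtUnity` on the SAME θ that produces the datum — form (i): explicit θ-binders).  B5 at every ₁₂C record gives, A FORTIORI, the θ-keyed sentence
«∀ θ h, θ.ZtUnity F N → θ.Admissible → (B) → END → HybridNE7Under (datumOfRecord₁₂ θ h) END» (worlds eliminated by `spine_rec12C_iff_forall_datumOfRecord₁₂`; the unity guard and the two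
displayed antecedents are not used).  Under form (ii) (`IsRecordOfRecord₁₂CU := ∃ θ h, θ.ZtUnity F N ∧ …`) the same weakening is XII `spine_antitone`. [bookkeeping] -/
theorem k3ShapeUnity_of_spine_rec12C (h : Spine (N := N) fun F D w => IsRecordOfRecord₁₂C F N D w)
    (F : T4Family) (θ : Stage12Params F N) (hP : θ.Provisos₁₂ F N) (_hU : θ.ZtUnity F N) (hθ : θ.Admissible F N)
    (_hB : B16.EndStatementBPrinted (datumOfRecord₁₂ F N θ hP).C) (_hE : DagBinding.EndpointExistence (datumOfRecord₁₂ F N θ hP).C.toB12) :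
    T4ApexHybrid.HybridNE7Under (datumOfRecord₁₂ F N θ hP) (DagBinding.EndpointExistence (datumOfRecord₁₂ F N θ hP).C.toB12) :=
  spine_rec12C_iff_forall_datumOfRecord₁₂.mp h F θ hP hθ

end K3Shape

/-! ## §5 THE UNITY-KEYED FORM (director LINE №99 (2), form (i)): B5 at every UNITY-admissible Stage-12 datum, from faces guarded by `θ.ZtUnity` -/

section UnityKeyed

variable (cr : (F : T4Family) → (θ : Stage12Params F N) → θ.Provisos₁₂ F N → (ℕ → ℝ) → List (ULoop F) → SpineCarriers)
  (rr : (F : T4Family) → (θ : Stage12Params F N) → θ.Provisos₁₂ F N → (ℕ → ℝ) → List (ULoop F) → RateCarriers N)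

/-- **THE UNITY-KEYED K3′ CONCLUSION FROM UNITY-GUARDED KEYED FACES** (XXIV at the key `Adm := θ.ZtUnity F N ∧ θ.Admissible F N`, record class «the datum is unity-keyed», world not read: (K1) the identity, (K2) the degenerate
`Node00.nonempty_worldP`; = the stage-generic world-free form, companion module XXIVb `forall_guarded_of_keyedFaces`): if the five keyed faces of `spine_rec12C_of_keyedFaces` hold for every Stage-12 θ with provisos satisfying
`θ.ZtUnity` AND `θ.Admissible F N` (the children's estimates are only ASKED on print's partition-of-unity class), then «∀ θ h, θ.ZtUnity F N → θ.Admissible F N →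
HybridNE7Under (datumOfRecord₁₂ F N θ h) END» — the re-pinned item K3′'s sentence at `N = 2` up to its two displayed antecedents (module XXVI). [bookkeeping] -/
theorem keyedUnity₁₂_of_keyedFaces
    (h20 : ∀ (F : T4Family) (θ : Stage12Params F N) (hP : θ.Provisos₁₂ F N), θ.ZtUnity F N → θ.Admissible F N → ∀ (g₀ : ℕ → ℝ) (os : List (ULoop F)),
      RelWeightBound (cr F θ hP g₀ os).l₀ (cr F θ hP g₀ os).T (cr F θ hP g₀ os).A (cr F θ hP g₀ os).B (cr F θ hP g₀ os).Bad (cr F θ hP g₀ os).W)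
    (h21 : ∀ (F : T4Family) (θ : Stage12Params F N) (hP : θ.Provisos₁₂ F N), θ.ZtUnity F N → θ.Admissible F N → ∀ (g₀ : ℕ → ℝ) (os : List (ULoop F)),
      ShellWeightBound (cr F θ hP g₀ os).l₀ (cr F θ hP g₀ os).T (cr F θ hP g₀ os).A (cr F θ hP g₀ os).B (cr F θ hP g₀ os).shA (cr F θ hP g₀ os).shB
        (cr F θ hP g₀ os).Wsh)
    (hrates : ∀ (F : T4Family) (θ : Stage12Params F N) (hP : θ.Provisos₁₂ F N), θ.ZtUnity F N → θ.Admissible F N → ∀ (g₀ : ℕ → ℝ) (os : List (ULoop F)),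
      RatesAt (datumOfRecord₁₂ F N θ hP) (rr F θ hP g₀ os))
    (h19 : ∀ (F : T4Family) (θ : Stage12Params F N) (hP : θ.Provisos₁₂ F N), θ.ZtUnity F N → θ.Admissible F N → ∀ (g₀ : ℕ → ℝ) (os : List (ULoop F)),
      RatesAt (datumOfRecord₁₂ F N θ hP) (rr F θ hP g₀ os) → letI := (cr F θ hP g₀ os).dec
        ∃ δ : ℕ → ℝ, NE7.Core (cr F θ hP g₀ os).l₀ (cr F θ hP g₀ os).vol (cr F θ hP g₀ os).T (cr F θ hP g₀ os).Bad
          (fun K t τ => (cr F θ hP g₀ os).A K t τ - (cr F θ hP g₀ os).shA K t τ) (fun K t τ => (cr F θ hP g₀ os).B K t τ - (cr F θ hP g₀ os).shB K t τ) δ ∧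
          Summable δ)
    (hx : ∀ (F : T4Family) (θ : Stage12Params F N) (hP : θ.Provisos₁₂ F N), θ.ZtUnity F N → θ.Admissible F N →
      B16.EndStatementBPrinted (datumOfRecord₁₂ F N θ hP).C → DagBinding.EndpointExistence (datumOfRecord₁₂ F N θ hP).C.toB12 →
        ForSmallCouplings (datumOfRecord₁₂ F N θ hP) fun g₀ => ∀ os : List (ULoop F),
          0 < (cr F θ hP g₀ os).l₀ ∧ 0 < (cr F θ hP g₀ os).vol ∧
          (∀ (K : ℕ) (t : ℝ), |t| ≤ (cr F θ hP g₀ os).l₀ →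
            T4GenFunBounds.schemeZ ((datumOfRecord₁₂ F N θ hP).scheme g₀) os ((cr F θ hP g₀ os).K₀ + K) t =
              ∑ τ ∈ (cr F θ hP g₀ os).T K, (cr F θ hP g₀ os).A K t τ) ∧
          (∀ (K : ℕ) (t : ℝ), |t| ≤ (cr F θ hP g₀ os).l₀ →
            T4GenFunBounds.schemeZ ((datumOfRecord₁₂ F N θ hP).scheme g₀) os ((cr F θ hP g₀ os).K₀ + K + 1) t =
              ∑ τ ∈ (cr F θ hP g₀ os).T K, (cr F θ hP g₀ os).B K t τ))
    (F : T4Family) (θ : Stage12Params F N) (hP : θ.Provisos₁₂ F N) (hU : θ.ZtUnity F N) (hθ : θ.Admissible F N) :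
    T4ApexHybrid.HybridNE7Under (datumOfRecord₁₂ F N θ hP) (DagBinding.EndpointExistence (datumOfRecord₁₂ F N θ hP).C.toB12) := by
  obtain ⟨w₀⟩ := Node00.nonempty_worldP
  have hS : Spine (N := N) (fun F D _ => ∃ (θ : Stage12Params F N) (hP : θ.Provisos₁₂ F N), (θ.ZtUnity F N ∧ θ.Admissible F N) ∧ D = datumOfRecord₁₂ F N θ hP) :=
    spine_of_keyedFaces (Θ := fun F => Stage12Params F N) (fun θ => θ.Provisos₁₂ _ N) (fun θ => θ.ZtUnity _ N ∧ θ.Admissible _ N)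
      (fun θ h => datumOfRecord₁₂ _ N θ h) _ (fun θ h => cr _ θ h) (fun θ h => rr _ θ h) (fun _ _ _ hR => hR)
      (fun F θ hP hA => h20 F θ hP hA.1 hA.2) (fun F θ hP hA => h21 F θ hP hA.1 hA.2) (fun F θ hP hA => hrates F θ hP hA.1 hA.2)
      (fun F θ hP hA => h19 F θ hP hA.1 hA.2) (fun F θ hP hA => hx F θ hP hA.1 hA.2)
  exact forall_keyed_of_spine (Θ := fun F => Stage12Params F N) (fun θ => θ.Provisos₁₂ _ N) (fun θ => θ.ZtUnity _ N ∧ θ.Admissible _ N)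
    (fun θ h => datumOfRecord₁₂ _ N θ h) _ (fun F θ h hA => ⟨w₀, θ, h, hA, rfl⟩) hS F θ hP ⟨hU, hθ⟩

end UnityKeyed

/-! ## §6 (v1.1, append-only) CARRIER-PIN INVARIANCE OF B5 AT STAGE 12 (module XX §2's Stage-11 faces at the repaired record): B5 at the plain `₁₂C` records ⟺ at the
four-pin `₁₂CB10YZW` ∕ five-pin `₁₂CB10YZWB8` ∕ seven-pin `₁₂CB10YZWB8B12B13` records of node00-def's `Node00/Record12CarriersRecords` ∕ `…B12` ∕ `…B13` — so a K5 ∕ N27x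
producer may state its product at the fully pinned class where the [B9]∕[B11]∕[IV]∕[B8]∕[B12]∕[B13] objects of record live, and B5 at `₁₂C` (hence K3′, module XXVI) follows -/

section CarrierPins

/-- **CARRIER-PIN INVARIANCE, FOUR PINS**: B5 at the plain Stage-12 records ⟺ B5 at the [B10]∕[B9]∕[B11]∕[IV]-pinned ones.  (→) the pinned class refines `₁₂C` with the SAME pair
(`Node00.isRecordOfRecord₁₂C_of_isRecordOfRecord₁₂CB10YZW`); (←) re-bind a `₁₂C` world by the four-pin view (`isRecordOfRecord₁₂CB10YZW_rebind_of_isRecordOfRecord₁₂C`, the zero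
operator layer `nonempty_opsY`, `nonempty_residZ`, `nonempty_residW`) — same datum, so `spine_of_shadow_anyWorld` applies. [bookkeeping] -/
theorem spine_rec12C_iff_spine_rec12CB10YZW :
    (Spine (N := N) fun F D w => IsRecordOfRecord₁₂C F N D w) ↔ Spine (N := N) fun F D w => Node00.IsRecordOfRecord₁₂CB10YZW F N D w := by
  refine ⟨spine_antitone fun F D w h => Node00.isRecordOfRecord₁₂C_of_isRecordOfRecord₁₂CB10YZW h, spine_of_shadow_anyWorld fun F D w h => ?_⟩
  obtain ⟨θ, hP, -, -, hre⟩ := Node00.isRecordOfRecord₁₂CB10YZW_rebind_of_isRecordOfRecord₁₂C h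
  obtain ⟨ops⟩ := nonempty_opsY N θ.toStage3Params 0
  obtain ⟨ζ⟩ := Node00.nonempty_residZ F N
  obtain ⟨lamW⟩ := Node00.nonempty_residW F N
  exact ⟨D, _, hre 0 ops ζ lamW, rfl, rfl⟩

/-- **CARRIER-SUFFIX INVARIANCE, FIVE PINS** (`[B8]` surviving): B5 at the plain Stage-12 records ⟺ B5 at the five-pin ones.  (→) a five-pin record has a SAME-DATUM companion in the
four-pin class (`Node00.companion_of_isRecordOfRecord₁₂CB10YZWB8`), which refines `₁₂C`; (←) re-bind by the S-binding at the five-pin view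
(`isRecordOfRecord₁₂CB10YZWB8_rebind_of_isRecordOfRecord₁₂C`; `nonempty_residB8` for the fifth layer). [bookkeeping] -/
theorem spine_rec12C_iff_spine_rec12CB10YZWB8 :
    (Spine (N := N) fun F D w => IsRecordOfRecord₁₂C F N D w) ↔ Spine (N := N) fun F D w => Node00.IsRecordOfRecord₁₂CB10YZWB8 F N D w := by
  refine ⟨spine_of_shadow_anyWorld fun F D w h => ?_, spine_of_shadow_anyWorld fun F D w h => ?_⟩
  · obtain ⟨w', h', -⟩ := Node00.companion_of_isRecordOfRecord₁₂CB10YZWB8 h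
    exact ⟨D, w', Node00.isRecordOfRecord₁₂C_of_isRecordOfRecord₁₂CB10YZW h', rfl, rfl⟩
  · obtain ⟨θ, hP, -, -, hre⟩ := Node00.isRecordOfRecord₁₂CB10YZWB8_rebind_of_isRecordOfRecord₁₂C h
    obtain ⟨lam⟩ := Node00.nonempty_residB8 (θ := θ.toStage3Params)
    obtain ⟨ops⟩ := nonempty_opsY N θ.toStage3Params 0
    obtain ⟨ζ⟩ := Node00.nonempty_residZ F N
    obtain ⟨lamW⟩ := Node00.nonempty_residW F N
    exact ⟨D, _, hre lam 0 ops ζ lamW, rfl, rfl⟩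

/-- **CARRIER-SUFFIX INVARIANCE, SEVEN PINS** (`[B8]` surviving, [B12]∕[B13] pinned — the class where the dressed expansion's objects of record live): B5 at the plain Stage-12
records ⟺ B5 at the seven-pin ones.  (→) seven pins refine five (`isRecordOfRecord₁₂CB10YZWB8_of_isRecordOfRecord₁₂CB10YZWB8B12B13`), then the five-pin companion road; (←) re-bind by
the S-binding at the seven-pin view (`isRecordOfRecord₁₂CB10YZWB8B12B13_rebind_of_isRecordOfRecord₁₂C`; `nonempty_residB13`, `nonempty_residB12`, `nonempty_residB8`, …). [bookkeeping] -/
theorem spine_rec12C_iff_spine_rec12CB10YZWB8B12B13 :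
    (Spine (N := N) fun F D w => IsRecordOfRecord₁₂C F N D w) ↔ Spine (N := N) fun F D w => Node00.IsRecordOfRecord₁₂CB10YZWB8B12B13 F N D w := by
  refine ⟨spine_of_shadow_anyWorld fun F D w h => ?_, spine_of_shadow_anyWorld fun F D w h => ?_⟩
  · obtain ⟨w', h', -⟩ := Node00.companion_of_isRecordOfRecord₁₂CB10YZWB8 (Node00.isRecordOfRecord₁₂CB10YZWB8_of_isRecordOfRecord₁₂CB10YZWB8B12B13 h)
    exact ⟨D, w', Node00.isRecordOfRecord₁₂C_of_isRecordOfRecord₁₂CB10YZW h', rfl, rfl⟩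
  · obtain ⟨θ, hP, -, -, hre⟩ := Node00.isRecordOfRecord₁₂CB10YZWB8B12B13_rebind_of_isRecordOfRecord₁₂C h
    obtain ⟨l13⟩ := Node00.nonempty_residB13 (θ := θ.toStage3Params)
    obtain ⟨lam12⟩ := Node00.nonempty_residB12 F N θ.τ9.M
    obtain ⟨lam⟩ := Node00.nonempty_residB8 (θ := θ.toStage3Params)
    obtain ⟨ops⟩ := nonempty_opsY N θ.toStage3Params 0
    obtain ⟨ζ⟩ := Node00.nonempty_residZ F N
    obtain ⟨lamW⟩ := Node00.nonempty_residW F N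
    exact ⟨D, _, hre (fun _ => l13) lam12 lam 0 ops ζ lamW, rfl, rfl⟩

/-- **HENCE THE KNITS MAY BE RUN AT THE SEVEN-PIN CLASS**: for any spine ∕ rate records and inputs, the rev-1 stub-level road XIV (or any road) concluding `Spine` at
`₁₂CB10YZWB8B12B13` — where `S_R00x`∕`S_N27x` are asked only at the fully pinned records — gives B5 at `₁₂C` (and conversely). [bookkeeping] -/
theorem spine_rec12C_of_spine_rec12CB10YZWB8B12B13 (h : Spine (N := N) fun F D w => Node00.IsRecordOfRecord₁₂CB10YZWB8B12B13 F N D w) :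
    Spine (N := N) fun F D w => IsRecordOfRecord₁₂C F N D w :=
  spine_rec12C_iff_spine_rec12CB10YZWB8B12B13.mpr h

end CarrierPins

end Summit.QuantumFields.YangMills.Theorems.BalabanUVNodesN27SpineRecord
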